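import Summits.CriticalPhenomena.PercolationContinuityZ3.Theorems.PercNearOneGluingNoHeavyLowerTailSahiFrontierTransfer
import Summits.CriticalPhenomena.PercolationContinuityZ3.Theorems.PercNearOneGluingNoHeavyLowerTailSahiSunflowerRowClosedForm
import Literature.Combinatorics.Sahi2008.UniformSquareAllOrders
import Mathlib.Tactic.Linarith
import HarnessLib

/-!
# `NoHeavyLowerTail` (crux stmt-CriticalPhenomena-4575), master-family line P2: FLOOR TRANSFER and the DOUBLY-TERMINAL reduction of Sahi's `C_n`

Support file (seat `prim-masterthm-p2`, gen 4; `--supports stmt-CriticalPhenomena-4575`); no definition, no named fact, no sorry.  Memo SAHI-ROUTE.md §4.14.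
Companion of `…SahiFrontierTransfer` (adding to a member a point missed by another member does not increase `E_n`).  The DUAL move:

* **FLOOR MONOTONICITY** (`sahiE_upperSet_erase_le`): for a weight Sahi-positive of the orders `≤ n+1` on a finite poset and up-sets `W_i`, REMOVING from
  `W_{i₀}` a point `m` that lies in EVERY other member does not increase `E_{n+2}`.  [`E(W) − E(W') = E(χ_{m} at slot i₀, others)`; the cell `{m}` has the
  same moments against the other members as `(ν(m)/ν(M))·χ_M`, `M = ⋂_{j ≠ i₀} W_j` an up-set NESTED in every other member, whose `E` is `≥ 0` by the peel
  lemma `SahiCubeAllOrders.sahiE_setInd_nonneg_of_nested`.]  If `m` is a FLOOR point (minimal element) of `W_{i₀}` the new family is again a family of up-sets.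
* **DOUBLY-TERMINAL REDUCTION** (`sahiE_setInd_nonneg_of_doublyTerminal`, `sahiPositive_of_doublyTerminal`, `sahiPositive_three_iff_doublyTerminal`):
  given the orders `≤ n+1`, order `n+2` holds iff `E_{n+2} ≥ 0` on the families of up-sets that are FRONTIER-TERMINAL (every maximal non-member of each
  member lies in all other members) AND FLOOR-TERMINAL (no minimal element of a member lies in all other members).  Two-phase descent: frontier additions
  first (`…SahiFrontierTransfer`), then floor removals, which preserve frontier-terminality.  On the sunflower poset `Sun m` the doubly-terminal
  co-singleton families are exactly the merged sub-rows — this is the abstract form of the all-`m` hierarchy theorem's reduction; on the cube `{0,1}^4`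
  (census, seat code/frontier4c.py, dterm_analyze.py): of 804 440 unordered triples of up-sets 330 are doubly terminal, 22 orbits mod `Sym(4)` without a
  trivial member, 17 without an independent member (e.g. the OR-triangle `(x₀∨x₁, x₀∨x₂, x₁∨x₂)`, `(x₀(x₁∨x₂), x₁∨x₃, x₂∨x₃)`); 1 977 555 floor moves, 0 increases of `E_3`.
  For every FKG probability weight on a finite distributive lattice (product measures: Kahn's setting) **`C_3` ⟺ `E_3 ≥ 0` on the doubly-terminal triples**.
-/

namespace Summit.CriticalPhenomena.PercolationContinuityZ3.Theorems

namespace SahiFrontierTransfer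

open Finset Function Literature.Combinatorics.Sahi2008

variable {α : Type*} [Fintype α] [DecidableEq α]

omit [Fintype α] in
/-- `χ_S = χ_{S ∖ m} + χ_{{m}}` for `m ∈ S`. [this work] -/
theorem setInd_eq_erase_add {m : α} {S : Finset α} (h : m ∈ S) : setInd S = setInd (S.erase m) + setInd ({m} : Finset α) := by
  conv_lhs => rw [← Finset.insert_erase h]
  exact setInd_insert (Finset.notMem_erase m S)

section Poset

variable [PartialOrder α]

/-- **FLOOR MONOTONICITY.**  If the weight is Sahi-positive of every order `≤ n+1`, then for up-sets `W_i` and a point `m ∈ W_{i₀}` lying in EVERY other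
member, removing `m` from `W_{i₀}` does not increase `E_{n+2}`. [this work] -/
theorem sahiE_upperSet_erase_le {ν : α → ℝ} (hν0 : ∀ y, 0 ≤ ν y) (hν1 : ∑ y, ν y = 1) {n : ℕ} (hlow : ∀ k, k ≤ n + 1 → SahiPositive ν k)
    (W : Fin (n + 2) → Finset α) (hW : ∀ i, IsUpperSet ((W i : Finset α) : Set α)) {m : α} {i₀ : Fin (n + 2)} (hm : m ∈ W i₀)
    (hall : ∀ j, j ≠ i₀ → m ∈ W j) :
    sahiE ν (n + 2) (fun l => setInd (update W i₀ ((W i₀).erase m) l)) ≤ sahiE ν (n + 2) (fun l => setInd (W l)) := by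
  set G : Fin (n + 2) → α → ℝ := fun l => setInd (W l) with hG
  -- `E(W) = E(W') + E(χ_{m} at i₀)`
  have hsplit : sahiE ν (n + 2) G = sahiE ν (n + 2) (fun l => setInd (update W i₀ ((W i₀).erase m) l)) +
      sahiE ν (n + 2) (update G i₀ (setInd ({m} : Finset α))) := by
    have h1 : G = update G i₀ (setInd ((W i₀).erase m) + setInd ({m} : Finset α)) := by
      rw [← setInd_eq_erase_add hm, hG, update_eq_self]
    have h2 : (fun l => setInd (update W i₀ ((W i₀).erase m) l)) = update G i₀ (setInd ((W i₀).erase m)) := by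
      funext l
      by_cases hl : l = i₀
      · subst hl; rw [update_self, update_self]
      · rw [update_of_ne hl, update_of_ne hl]
    rw [h2]
    conv_lhs => rw [h1]
    rw [sahiE_update_add]
  -- the intersection of the other members
  set M : Finset α := univ.filter (fun y => ∀ j, j ≠ i₀ → y ∈ W j) with hM
  have hMsub : ∀ j, j ≠ i₀ → M ⊆ W j := fun j hj y hy => (Finset.mem_filter.1 hy).2 j hj
  have hmM : m ∈ M := Finset.mem_filter.2 ⟨Finset.mem_univ _, hall⟩
  have hMup : IsUpperSet ((M : Finset α) : Set α) := by
    intro x y hxy hx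
    rw [Finset.mem_coe, hM, Finset.mem_filter] at hx ⊢
    exact ⟨Finset.mem_univ _, fun j hj => Finset.mem_coe.1 (hW j hxy (Finset.mem_coe.2 (hx.2 j hj)))⟩
  -- moments of `{m}` and of `M` against the other members
  have hprodM : ∀ S : Finset (Fin (n + 2)), i₀ ∉ S → ∀ y, y ∈ M → (∏ l ∈ S, G l) y = 1 := by
    intro S hS y hy
    rw [Finset.prod_apply]
    refine Finset.prod_eq_one fun l hl => ?_
    have hli : l ≠ i₀ := fun e => hS (e ▸ hl)
    rw [hG]; dsimp only; rw [setInd_apply, if_pos (hMsub l hli hy)]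
  have hmom : ∀ S : Finset (Fin (n + 2)), i₀ ∉ S →
      ex ν (((∑ y ∈ M, ν y) : ℝ) • setInd ({m} : Finset α) * ∏ l ∈ S, G l) = ex ν ((ν m) • setInd M * ∏ l ∈ S, G l) := by
    intro S hS
    have e1 : ((∑ y ∈ M, ν y) : ℝ) • setInd ({m} : Finset α) * ∏ l ∈ S, G l = (∑ y ∈ M, ν y) • setInd ({m} : Finset α) := by
      funext y
      simp only [Pi.mul_apply, Pi.smul_apply, smul_eq_mul, setInd_apply, Finset.mem_singleton]
      by_cases hy : y = m
      · subst hy; rw [if_pos rfl, hprodM S hS _ hmM]; ring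
      · rw [if_neg hy]; ring
    have e2 : (ν m) • setInd M * ∏ l ∈ S, G l = (ν m) • setInd M := by
      funext y
      simp only [Pi.mul_apply, Pi.smul_apply, smul_eq_mul, setInd_apply]
      by_cases hy : y ∈ M
      · rw [if_pos hy, hprodM S hS y hy]; ring
      · rw [if_neg hy]; ring
    rw [e1, e2, ex_smul, ex_smul, SahiDeltaSystem.Sun.ex_setInd_eq_sum, SahiDeltaSystem.Sun.ex_setInd_eq_sum, Finset.sum_singleton]
    ring
  have hcongr := sahiE_update_congr_of_moments ν G i₀ hmom
  rw [sahiE_update_smul, sahiE_update_smul] at hcongr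
  -- the nested family `(M at i₀, others)` is nonnegative by the peel lemma
  have hnested : 0 ≤ sahiE ν (n + 2) (update G i₀ (setInd M)) := by
    obtain ⟨j, hj⟩ := exists_ne i₀
    have hfam : update G i₀ (setInd M) = fun l => setInd (update W i₀ M l) := by
      funext l
      by_cases hl : l = i₀
      · subst hl; rw [update_self, update_self]
      · rw [update_of_ne hl, update_of_ne hl]
    rw [hfam]
    refine SahiCubeAllOrders.sahiE_setInd_nonneg_of_nested hν0 hν1
      (fun V hV => (sahiPositive_iff_indicators ν (n + 1)).1 (hlow (n + 1) le_rfl) V hV) (update W i₀ M) (fun l => ?_) hj ?_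
    · by_cases hl : l = i₀
      · subst hl; rw [update_self]; exact hMup
      · rw [update_of_ne hl]; exact hW l
    · rw [update_self, update_of_ne hj]; exact hMsub j hj
  have hMm : ν m ≤ ∑ y ∈ M, ν y := Finset.single_le_sum (fun y _ => hν0 y) hmM
  have hkey : 0 ≤ sahiE ν (n + 2) (update G i₀ (setInd ({m} : Finset α))) := by
    by_cases hM0 : ∑ y ∈ M, ν y = 0
    · -- then `ν m = 0` and the `{m}` slot has zero moments
      have hm0 : ν m = 0 := le_antisymm (hM0 ▸ hMm) (hν0 m)
      have hz : sahiE ν (n + 2) (update G i₀ (setInd ({m} : Finset α))) = sahiE ν (n + 2) (update G i₀ 0) := by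
        refine sahiE_update_congr_of_moments ν G i₀ fun S hS => ?_
        rw [zero_mul, ex_def, ex_def]
        refine Finset.sum_congr rfl fun y _ => ?_
        simp only [Pi.mul_apply, setInd_apply, Finset.mem_singleton, Pi.zero_apply, mul_zero]
        by_cases hy : y = m
        · subst hy; rw [hm0]; ring
        · rw [if_neg hy]; ring
      rw [hz, sahiE_update_zero]
    · have hMpos : 0 < ∑ y ∈ M, ν y := lt_of_le_of_ne (Finset.sum_nonneg fun y _ => hν0 y) (Ne.symm hM0)
      have h2 : 0 ≤ (∑ y ∈ M, ν y) * sahiE ν (n + 2) (update G i₀ (setInd ({m} : Finset α))) := by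
        rw [hcongr]; exact mul_nonneg (hν0 m) hnested
      exact nonneg_of_mul_nonneg_right h2 hMpos
  linarith [hsplit]

omit [Fintype α] [DecidableEq α] in
/-- Removing a FLOOR point (a minimal element) from an up-set gives an up-set. [this work] -/
theorem isUpperSet_erase_of_floor [DecidableEq α] {U : Finset α} (hU : IsUpperSet ((U : Finset α) : Set α)) {m : α}
    (hmin : ∀ y, y ∈ U → y ≤ m → y = m) : IsUpperSet ((U.erase m : Finset α) : Set α) := by
  intro x y hxy hx
  rw [Finset.mem_coe, Finset.mem_erase] at hx ⊢
  refine ⟨fun hym => ?_, Finset.mem_coe.1 (hU hxy (Finset.mem_coe.2 hx.2))⟩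
  subst hym
  exact hx.1 (hmin x hx.2 hxy)

omit [Fintype α] in
/-- **Floor removals preserve frontier-terminality.** [this work] -/
theorem frontierTerminal_erase {n : ℕ} (W : Fin (n + 2) → Finset α) {m : α} {i₀ : Fin (n + 2)} (hall : ∀ j, j ≠ i₀ → m ∈ W j)
    (hT1 : ∀ i z, z ∉ W i → (∀ y, z < y → y ∈ W i) → ∀ j, j ≠ i → z ∈ W j) :
    ∀ i z, z ∉ update W i₀ ((W i₀).erase m) i → (∀ y, z < y → y ∈ update W i₀ ((W i₀).erase m) i) →
      ∀ j, j ≠ i → z ∈ update W i₀ ((W i₀).erase m) j := by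
  intro i z hz hfront j hji
  by_cases hi : i = i₀
  · subst hi
    rw [update_self] at hz hfront
    rw [update_of_ne hji]
    by_cases hzm : z = m
    · subst hzm; exact hall j hji
    · have hz' : z ∉ W i := fun h => hz (Finset.mem_erase.2 ⟨hzm, h⟩)
      exact hT1 i z hz' (fun y hy => Finset.mem_of_mem_erase (hfront y hy)) j hji
  · rw [update_of_ne hi] at hz hfront
    have hzj := hT1 i z hz hfront
    by_cases hj : j = i₀
    · subst hj
      rw [update_self, Finset.mem_erase]
      refine ⟨fun hzm => ?_, hzj j hji⟩
      subst hzm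
      exact hz (hall i hi)
    · rw [update_of_ne hj]; exact hzj j hji

/-- **DOUBLY-TERMINAL REDUCTION (indicator form).**  If the orders `≤ n+1` hold and `E_{n+2} ≥ 0` for every family of up-sets that is frontier-terminal
(every maximal non-member of each member lies in all other members) and floor-terminal (no minimal element of a member lies in all other members), then
`E_{n+2} ≥ 0` for EVERY family of up-sets. [this work] -/
theorem sahiE_setInd_nonneg_of_doublyTerminal {ν : α → ℝ} (hν0 : ∀ y, 0 ≤ ν y) (hν1 : ∑ y, ν y = 1) {n : ℕ}
    (hlow : ∀ k, k ≤ n + 1 → SahiPositive ν k)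
    (hterm : ∀ W : Fin (n + 2) → Finset α, (∀ i, IsUpperSet ((W i : Finset α) : Set α)) →
      (∀ i z, z ∉ W i → (∀ y, z < y → y ∈ W i) → ∀ j, j ≠ i → z ∈ W j) →
      (∀ i m, m ∈ W i → (∀ y, y ∈ W i → y ≤ m → y = m) → ∃ j, j ≠ i ∧ m ∉ W j) →
        0 ≤ sahiE ν (n + 2) (fun i => setInd (W i))) :
    ∀ W : Fin (n + 2) → Finset α, (∀ i, IsUpperSet ((W i : Finset α) : Set α)) → 0 ≤ sahiE ν (n + 2) (fun i => setInd (W i)) := by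
  refine sahiE_setInd_nonneg_of_terminal hν0 hlow fun W hW hT1 => ?_
  -- second phase: floor removals, by strong induction on the total size, keeping frontier-terminality
  suffices h : ∀ (s : ℕ) (W : Fin (n + 2) → Finset α), (∑ i, (W i).card) = s → (∀ i, IsUpperSet ((W i : Finset α) : Set α)) →
      (∀ i z, z ∉ W i → (∀ y, z < y → y ∈ W i) → ∀ j, j ≠ i → z ∈ W j) → 0 ≤ sahiE ν (n + 2) (fun i => setInd (W i)) from
    h _ W rfl hW hT1
  intro s
  induction s using Nat.strong_induction_on with
  | _ s ih =>
    intro W hs hW hT1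
    by_cases hT2 : ∀ i m, m ∈ W i → (∀ y, y ∈ W i → y ≤ m → y = m) → ∃ j, j ≠ i ∧ m ∉ W j
    · exact hterm W hW hT1 hT2
    · push Not at hT2
      obtain ⟨i, m, hm, hmin, hall⟩ := hT2
      have hstep := sahiE_upperSet_erase_le hν0 hν1 hlow W hW hm hall
      refine le_trans ?_ hstep
      have hcard : ∑ l, (update W i ((W i).erase m) l).card < s := by
        have hfun : (fun l => (update W i ((W i).erase m) l).card) = update (fun l => (W l).card) i ((W i).card - 1) := by
          funext l
          by_cases hl : l = i
          · subst hl; rw [update_self, update_self, Finset.card_erase_of_mem hm]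
          · rw [update_of_ne hl, update_of_ne hl]
        rw [show (∑ l, (update W i ((W i).erase m) l).card) = ∑ l, (fun l => (update W i ((W i).erase m) l).card) l from rfl,
          hfun, Finset.sum_update_of_mem (Finset.mem_univ i), Finset.sdiff_singleton_eq_erase]
        have hpos : 0 < (W i).card := Finset.card_pos.2 ⟨m, hm⟩
        have htot := Finset.add_sum_erase Finset.univ (fun l => (W l).card) (Finset.mem_univ i)
        rw [← hs, ← htot]
        omega
      exact ih _ hcard _ rfl
        (fun l => by
          by_cases hl : l = i
          · subst hl; rw [update_self]; exact isUpperSet_erase_of_floor (hW l) hmin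
          · rw [update_of_ne hl]; exact hW l)
        (frontierTerminal_erase W hall hT1)

/-- **DOUBLY-TERMINAL REDUCTION.**  Orders `≤ n+1` and the doubly-terminal `(n+2)`-families give order `n+2`. [this work] -/
theorem sahiPositive_of_doublyTerminal {ν : α → ℝ} (hν0 : ∀ y, 0 ≤ ν y) (hν1 : ∑ y, ν y = 1) {n : ℕ}
    (hlow : ∀ k, k ≤ n + 1 → SahiPositive ν k)
    (hterm : ∀ W : Fin (n + 2) → Finset α, (∀ i, IsUpperSet ((W i : Finset α) : Set α)) →
      (∀ i z, z ∉ W i → (∀ y, z < y → y ∈ W i) → ∀ j, j ≠ i → z ∈ W j) →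
      (∀ i m, m ∈ W i → (∀ y, y ∈ W i → y ≤ m → y = m) → ∃ j, j ≠ i ∧ m ∉ W j) →
        0 ≤ sahiE ν (n + 2) (fun i => setInd (W i))) :
    SahiPositive ν (n + 2) :=
  (sahiPositive_iff_indicators ν (n + 2)).2 (sahiE_setInd_nonneg_of_doublyTerminal hν0 hν1 hlow hterm)

/-- **All orders ⟺ the doubly-terminal families**, for a probability weight on a finite poset. [this work] -/
theorem sahiPositive_all_iff_doublyTerminal {ν : α → ℝ} (hν0 : ∀ y, 0 ≤ ν y) (hν1 : ∑ y, ν y = 1) :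
    (∀ n, SahiPositive ν n) ↔ ∀ (n : ℕ) (W : Fin (n + 2) → Finset α), (∀ i, IsUpperSet ((W i : Finset α) : Set α)) →
      (∀ i z, z ∉ W i → (∀ y, z < y → y ∈ W i) → ∀ j, j ≠ i → z ∈ W j) →
      (∀ i m, m ∈ W i → (∀ y, y ∈ W i → y ≤ m → y = m) → ∃ j, j ≠ i ∧ m ∉ W j) →
        0 ≤ sahiE ν (n + 2) (fun i => setInd (W i)) := by
  constructor
  · intro h n W hW _ _
    exact (sahiPositive_iff_indicators ν (n + 2)).1 (h (n + 2)) W hW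
  · intro hterm n
    induction n using Nat.strong_induction_on with
    | _ n ih =>
      rcases n with _ | _ | k
      · exact sahiPositive_zero ν
      · exact sahiPositive_one hν0
      · exact sahiPositive_of_doublyTerminal hν0 hν1 (fun j hj => ih j (by omega)) (hterm k)

/-- **`C_3` ⟺ doubly-terminal triples**, for every FKG probability weight on a finite distributive lattice (product measures: Kahn's setting): Sahi positivity
of order 3 holds iff `E_3(χ_A, χ_B, χ_C) ≥ 0` for the triples of up-sets in which every maximal non-member of each member lies in the other two and no minimal
element of a member lies in both others. [this work] -/
theorem sahiPositive_three_iff_doublyTerminal {β : Type*} [DistribLattice β] [Fintype β] [DecidableEq β] {μ : β → ℝ} (hμ : IsFKGMeasure μ) :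
    SahiPositive μ 3 ↔ ∀ W : Fin 3 → Finset β, (∀ i, IsUpperSet ((W i : Finset β) : Set β)) →
      (∀ i z, z ∉ W i → (∀ y, z < y → y ∈ W i) → ∀ j, j ≠ i → z ∈ W j) →
      (∀ i m, m ∈ W i → (∀ y, y ∈ W i → y ≤ m → y = m) → ∃ j, j ≠ i ∧ m ∉ W j) →
        0 ≤ sahiE μ 3 (fun i => setInd (W i)) := by
  constructor
  · intro h W hW _ _
    exact (sahiPositive_iff_indicators μ 3).1 h W hW
  · intro hterm
    exact sahiPositive_of_doublyTerminal hμ.nonneg hμ.sum_eq_one (fun k hk => sahiPositive_of_le_two hμ (by omega)) hterm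

end Poset

end SahiFrontierTransfer

end Summit.CriticalPhenomena.PercolationContinuityZ3.Theorems
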